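import Literature.Analysis.FluidPDE.ClassicalSolutionRescale
import Literature.Analysis.FluidPDE.LeraySelfSimilarCalculus
import Literature.Analysis.FluidPDE.NecasRuzickaSverakHolds
import Literature.Analysis.FluidPDE.TsaiSelfSimilarHolds
import Literature.Analysis.FluidPDE.ChaeWolfRemovingDSSProofs
import Summits.NavierStokesRegularity.FluidComputer.SelfSimilarForceVanishing
import HarnessLib

/-!
# No exactly self-similar blow-up with a force continuous at the singular point
# (the "EXACT-ANSATZ WALL" of the `E–C` endpoint audit, kernel form)

HONEST FRAMING (cell `ns-blowup`, seat `ns-blowup-ecbridge-2` g0, human ruling D-0035): this cell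
ATTEMPTS the negative direction of the Clay problem; nothing in this file is evidence about
Navier–Stokes regularity. WHAT THIS IS NOT: not a statement about general (Type II, or coarsely
discretely self-similar non-axisymmetric Type I) singularities — only about EXACT (discrete)
self-similarity of the velocity–pressure PAIR near the singular point, the refuter's "EXACT-ANSATZ"
row (KILLSHEET §V.0, `run/shared/lean/pub/ns-blowup/KILLSHEET.md`), now end-to-end kernel-grade.

The question of the cell's `E–C` endpoint (Clay (C), forced breakdown): can a blow-up construction
come with a force that is smooth — hence continuous — THROUGH the blow-up time `T*`? For exactly
self-similar constructions the answer is NO, unconditionally: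

* `force_dss_of_classical_dss` — if a classical solution `(u, p)` of the FORCED system on the backward
  slab `(-T, 0) × E` is exactly `λ`-DSS there as a pair (`λ u(λ²t, λx) = u(t,x)`,
  `λ² p(λ²t, λx) = p(t,x)`, one `0 < λ ≤ 1`), then its force is DSS of degree `-3`:
  `f(t,x) = λ³ f(λ²t, λx)` on the slab (the tree's proved scale covariance
  `IsClassicalNSSolutionOn.nsRescale_holds`: the rescaled pair, which IS `(u, p)` on the slab, solves
  the system with force `nsRescaleForce λ f`; the momentum equation determines the force).
* `force_eq_zero_of_classical_dss_of_continuousAt` / `…_Iio` — if moreover `λ < 1` and `f` is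
  continuous at the vertex `(0, 0)`, then `f ≡ 0` on the slab (the scaling lemma
  `SelfSimilarForceVanishing.eq_zero_on_backwardCylinder_of_dss_of_continuousAt`): the blow-up is
  UNFORCED, so every unforced exclusion applies verbatim.
* `isLerayProfile_of_forced_lerayBackward` — Leray's exactly self-similar ansatz
  `u = (2a(-t))^{-1/2} U(x/√(2a(-t)))`, `p = (2a(-t))^{-1} P(x/√(2a(-t)))` solving the FORCED system
  on `(-∞, 0) × E` with a force continuous at `(0, 0)`: the force vanishes and `(U, P)` solves Leray's
  unforced profile system (tree: `lerayBackward_isClassical_iff_holds`).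
* `lerayBackward_forced_profile_eq_zero` — hence on `ℝ³`, with `U ∈ L^q`, `3 ≤ q < ∞`: `U = 0`
  (Nečas–Růžička–Šverák 1996 Thm. 1 = `necas_ruzicka_sverak_holds`; Tsai 1998 Thm. 1 =
  `tsai_selfsimilar_holds`; both proved in the tree). UNCONDITIONAL: a smooth (Clay-class) force
  buys nothing for Leray's ansatz.
* `dss_typeI_forced_eq_zero` (appended) — the discretely self-similar analogue with factor near `1`
  under a Type-I bound (Chae–Wolf 2017 Thm. 1.3 = `chaeWolf2017_removing_dss_holds`, proved in the
  tree): a forced classical `c`-DSS pair, `1 < c < c₁(C₀)`, with `‖u‖ ≤ C₀/(|x| + √-t)` and a force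
  continuous at the vertex has `u ≡ 0`. UNCONDITIONAL.

Blow-up time normalised to `0` and singular point to the origin (translate otherwise:
`IsClassicalNSSolutionOn.spaceTranslate`, `ClassicalSolutionGlue`).
-/

namespace Summit.NavierStokesRegularity.FluidComputer.SelfSimilarForceVanishing

open Set Filter Topology Function MeasureTheory Literature.Analysis.FluidPDE
open scoped ContDiff ENNReal

section NS

variable {E : Type*} [NormedAddCommGroup E] [InnerProductSpace ℝ E] [FiniteDimensional ℝ E]

/-- **The a-posteriori force of an exactly discretely self-similar classical pair is discretely
self-similar of degree `-3`.** Let `(u, p)` be a classical solution of the forced Navier–Stokes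
system (any `ν`) on the backward time interval `(-T, 0)` with force `f`, and suppose the PAIR is
exactly `λ`-DSS on the slab for one `0 < λ ≤ 1`: `λ u(λ²t, λx) = u(t, x)` and
`λ² p(λ²t, λx) = p(t, x)` for `t ∈ (-T, 0)`, all `x`. Then `f(t, x) = λ³ f(λ²t, λx)` on the slab.
Proof: by the tree's scale covariance `IsClassicalNSSolutionOn.nsRescale_holds` the rescaled pair —
which coincides with `(u, p)` on the slab — solves the system there with force
`nsRescaleForce λ f = λ³ f(λ²·, λ·)`; the momentum equation determines the force from `(u, p)`. -/
theorem force_dss_of_classical_dss {T ν l : ℝ} (hl0 : 0 < l) (hl1 : l ≤ 1)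
    {f u : ℝ → E → E} {p : ℝ → E → ℝ}
    (hsol : IsClassicalNSSolutionOn (Ioo (-T) 0) ν f u p)
    (hu : ∀ t ∈ Ioo (-T) 0, ∀ x, l • u (l ^ 2 * t) (l • x) = u t x)
    (hp : ∀ t ∈ Ioo (-T) 0, ∀ x, l ^ 2 * p (l ^ 2 * t) (l • x) = p t x) :
    ∀ t ∈ Ioo (-T) 0, ∀ x, f t x = l ^ 3 • f (l ^ 2 * t) (l • x) := by
  have hres := IsClassicalNSSolutionOn.nsRescale_holds hsol hl0
  have hl2 : 0 < l ^ 2 := by positivity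
  have hl2' : l ^ 2 ≤ 1 := pow_le_one₀ hl0.le hl1
  have hsub : Ioo (-T) 0 ⊆ (fun t => l ^ 2 * t) ⁻¹' Ioo (-T) 0 := by
    intro t ht
    simp only [mem_preimage, mem_Ioo]
    exact ⟨by nlinarith [ht.1, ht.2], mul_neg_of_pos_of_neg hl2 ht.2⟩
  have hres' := hres.mono hsub (uniqueDiffOn_Ioo (-T) 0)
  have hu' : ∀ t ∈ Ioo (-T) 0, nsRescale l u t = u t := fun t ht =>
    funext fun x => by rw [nsRescale_apply]; exact hu t ht x
  have hp' : ∀ t ∈ Ioo (-T) 0, nsRescalePressure l p t = p t := fun t ht =>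
    funext fun x => by rw [nsRescalePressure_apply]; exact hp t ht x
  intro t ht x
  have h1 := hsol.momentum t ht x
  have h2 := hres'.momentum t ht x
  have htd : timeDerivWithin (Ioo (-T) 0) (nsRescale l u) t x =
      timeDerivWithin (Ioo (-T) 0) u t x := by
    simp only [timeDerivWithin_apply]
    exact derivWithin_congr (fun s hs => congrFun (hu' s hs) x) (congrFun (hu' t ht) x)
  rw [htd, hu' t ht, hp' t ht, nsRescaleForce_apply] at h2
  exact add_left_cancel (h1.symm.trans h2)

/-- **EXACT-ANSATZ WALL, kernel form.** Let `(u, p)` be a classical solution of the forced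
Navier–Stokes system on the backward slab `(-T, 0) × E` whose PAIR is exactly `λ`-DSS there for
one `0 < λ < 1` (exact backward self-similarity is the case "every `λ`"). If the force `f` is
continuous at the space–time vertex `(0, 0)` (the putative singular point) — in particular if it is
a Clay-class force, smooth through the blow-up time — then `f ≡ 0` on the whole slab: the blow-up
is UNFORCED there, and every unforced exclusion of exact (discrete) self-similarity applies verbatim
(tree: `tsai_selfsimilar_local_energy_holds`, `necas_ruzicka_sverak_holds`,
`LeraySelfSimilarBlowupExclusion_holds`, `chaeWolf2017_removing_dss_holds` for `λ` near `1`). A smooth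
force buys nothing for exact self-similar ansätze (cell `ns-blowup`, KILLSHEET §V.0). -/
theorem force_eq_zero_of_classical_dss_of_continuousAt {T ν l : ℝ} (hT : 0 < T) (hl0 : 0 < l)
    (hl1 : l < 1) {f u : ℝ → E → E} {p : ℝ → E → ℝ}
    (hsol : IsClassicalNSSolutionOn (Ioo (-T) 0) ν f u p)
    (hu : ∀ t ∈ Ioo (-T) 0, ∀ x, l • u (l ^ 2 * t) (l • x) = u t x)
    (hp : ∀ t ∈ Ioo (-T) 0, ∀ x, l ^ 2 * p (l ^ 2 * t) (l • x) = p t x)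
    (hf : ContinuousAt (uncurry f) ((0 : ℝ), (0 : E))) :
    ∀ t ∈ Ioo (-T) 0, ∀ x, f t x = 0 := by
  have hrel := force_dss_of_classical_dss hl0 hl1.le hsol hu hp
  set g : ℝ × E → E := uncurry f with hg
  set r : ℝ := Real.sqrt T with hr
  have hr2 : r ^ 2 = T := Real.sq_sqrt hT.le
  -- the relation on the cylinder `Q_r`, `r = √T`
  have hgrel : ∀ z ∈ Ioo (-(r ^ 2)) 0 ×ˢ Metric.ball (0 : E) r,
      g z = (l ^ (3 : ℝ)) • g (l ^ 2 * z.1, l • z.2) := by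
    intro z hz
    rw [hr2] at hz
    have h3 : (l : ℝ) ^ (3 : ℝ) = l ^ (3 : ℕ) := by norm_cast
    rw [h3]
    exact hrel z.1 hz.1 z.2
  have hzero := eq_zero_on_backwardCylinder_of_dss_of_continuousAt hl0 hl1 (by norm_num : (0:ℝ) < 3)
    hgrel hf
  -- iterate the relation to reach the cylinder from any point of the slab
  have hiter : ∀ n : ℕ, ∀ t ∈ Ioo (-T) 0, ∀ x,
      f t x = (l ^ 3) ^ n • f ((l ^ 2) ^ n * t) (l ^ n • x) := by
    intro n
    induction n with
    | zero => intro t _ x; simp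
    | succ n ih =>
      intro t ht x
      have hl2 : 0 < l ^ 2 := by positivity
      have hmem : (l ^ 2) ^ n * t ∈ Ioo (-T) 0 := by
        have hq : 0 < (l ^ 2) ^ n := by positivity
        have hq' : (l ^ 2) ^ n ≤ 1 := pow_le_one₀ hl2.le (pow_le_one₀ hl0.le hl1.le)
        exact ⟨by nlinarith [ht.1, ht.2], mul_neg_of_pos_of_neg hq ht.2⟩
      rw [ih t ht x, hrel _ hmem, smul_smul, ← pow_succ, smul_smul, ← pow_succ',
        show l ^ 2 * ((l ^ 2) ^ n * t) = (l ^ 2) ^ (n + 1) * t by ring]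
  intro t ht x
  have hx : Tendsto (fun n : ℕ => l ^ n * ‖x‖) atTop (𝓝 0) := by
    simpa using (tendsto_pow_atTop_nhds_zero_of_lt_one hl0.le hl1).mul_const ‖x‖
  have hr0 : 0 < r := by rw [hr]; exact Real.sqrt_pos.2 hT
  obtain ⟨n, hn⟩ := (hx.eventually (gt_mem_nhds hr0)).exists
  have hmem : ((l ^ 2) ^ n * t, l ^ n • x) ∈ Ioo (-(r ^ 2)) 0 ×ˢ Metric.ball (0 : E) r := by
    have hq : 0 < (l ^ 2) ^ n := by positivity
    have hq' : (l ^ 2) ^ n ≤ 1 := pow_le_one₀ (by positivity) (pow_le_one₀ hl0.le hl1.le)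
    refine ⟨?_, ?_⟩
    · rw [hr2]; exact ⟨by nlinarith [ht.1, ht.2], mul_neg_of_pos_of_neg hq ht.2⟩
    · rw [Metric.mem_ball, dist_zero_right, norm_smul, norm_pow, Real.norm_of_nonneg hl0.le]
      exact hn
  rw [hiter n t ht x]
  have := hzero _ hmem
  simp only [hg, uncurry_apply_pair] at this
  rw [this, smul_zero]

/-- The conclusion of `force_eq_zero_of_classical_dss_of_continuousAt` on the whole backward
half-line: a classical `λ`-DSS pair on `(-∞, 0) × E` with a force continuous at the vertex has
`f ≡ 0` for all negative times. -/
theorem force_eq_zero_of_classical_dss_Iio {ν l : ℝ} (hl0 : 0 < l) (hl1 : l < 1)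
    {f u : ℝ → E → E} {p : ℝ → E → ℝ}
    (hsol : IsClassicalNSSolutionOn (Iio 0) ν f u p)
    (hu : ∀ t < 0, ∀ x, l • u (l ^ 2 * t) (l • x) = u t x)
    (hp : ∀ t < 0, ∀ x, l ^ 2 * p (l ^ 2 * t) (l • x) = p t x)
    (hf : ContinuousAt (uncurry f) ((0 : ℝ), (0 : E))) :
    ∀ t < 0, ∀ x, f t x = 0 := by
  intro t ht x
  have hT : 0 < -t + 1 := by linarith
  have hsub : Ioo (-(-t + 1)) 0 ⊆ Iio 0 := fun s hs => hs.2
  have hsol' := hsol.mono hsub (uniqueDiffOn_Ioo _ _)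
  exact force_eq_zero_of_classical_dss_of_continuousAt hT hl0 hl1 hsol'
    (fun s hs y => hu s hs.2 y) (fun s hs y => hp s hs.2 y) hf t ⟨by linarith, ht⟩ x

end NS

/-! ### Leray's exactly self-similar ansatz with a force -/

section Leray

variable {E : Type*} [NormedAddCommGroup E] [InnerProductSpace ℝ E] [FiniteDimensional ℝ E]

omit [InnerProductSpace ℝ E] [FiniteDimensional ℝ E] in
/-- Discrete (indeed full) self-similarity of the pressure of Leray's backward ansatz with blow-up
time `0`: `λ² P_a(λ²t, λx) = P_a(t, x)` for `t < 0`, `0 < λ`, where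
`P_a(t, x) = lerayBackwardPressure a 0 P t x = (2a(-t))⁻¹ P(x/√(2a(-t)))`. -/
theorem lerayBackwardPressure_zero_dss [NormedSpace ℝ E] (a : ℝ) (P : E → ℝ) {l : ℝ} (hl : 0 < l)
    {t : ℝ}
    (x : E) :
    l ^ 2 * lerayBackwardPressure a 0 P (l ^ 2 * t) (l • x) = lerayBackwardPressure a 0 P t x := by
  have hsq : Real.sqrt (2 * a * (0 - l ^ 2 * t)) = l * Real.sqrt (2 * a * (0 - t)) := by
    rw [show 2 * a * (0 - l ^ 2 * t) = l ^ 2 * (2 * a * (0 - t)) by ring,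
      Real.sqrt_mul (sq_nonneg l), Real.sqrt_sq hl.le]
  have hl' : l ≠ 0 := hl.ne'
  have e2 : (l * Real.sqrt (2 * a * (0 - t)))⁻¹ * l = (Real.sqrt (2 * a * (0 - t)))⁻¹ := by
    rw [mul_inv, mul_comm, ← mul_assoc, mul_inv_cancel₀ hl', one_mul]
  have e3 : ∀ X Q : ℝ, l ^ 2 * ((l ^ 2 * X)⁻¹ * Q) = X⁻¹ * Q := by
    intro X Q
    rw [mul_inv, ← mul_assoc, ← mul_assoc, mul_inv_cancel₀ (pow_ne_zero 2 hl'), one_mul]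
  simp only [lerayBackwardPressure]
  rw [hsq, smul_smul, e2, show 2 * a * (0 - l ^ 2 * t) = l ^ 2 * (2 * a * (0 - t)) by ring, e3]

/-- **Leray's exactly self-similar ansatz gains nothing from a force (profile equation).** Let
`U, P` be smooth profiles and `a > 0`, and suppose Leray's backward ansatz
`u = (2a(-t))^{-1/2} U(x/√(2a(-t)))`, `p = (2a(-t))^{-1} P(x/√(2a(-t)))` (blow-up time `0`)
solves the Navier–Stokes system on `(-∞, 0) × E` classically with SOME force `f` that is continuous
at the space–time vertex `(0, 0)`. Then `f ≡ 0` on `(-∞, 0) × E` and `(U, P)` solves Leray's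
UNFORCED profile system (`IsLerayProfile ν a U P`; the tree's discharged
`lerayBackward_isClassical_iff_holds`). -/
theorem isLerayProfile_of_forced_lerayBackward {ν a : ℝ} (ha : 0 < a) {U : E → E} {P : E → ℝ}
    (hU : ContDiff ℝ ∞ U) (hP : ContDiff ℝ ∞ P) {f : ℝ → E → E}
    (hsol : IsClassicalNSSolutionOn (Iio 0) ν f (lerayBackward a 0 U) (lerayBackwardPressure a 0 P))
    (hf : ContinuousAt (uncurry f) ((0 : ℝ), (0 : E))) :
    (∀ t < 0, ∀ x, f t x = 0) ∧ IsLerayProfile ν a U P := by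
  -- self-similarity of the pair, used with the factor `λ = 1/2`
  have hhalf0 : (0 : ℝ) < 1 / 2 := by norm_num
  have hhalf1 : (1 / 2 : ℝ) < 1 := by norm_num
  have hu : ∀ t < 0, ∀ x, (1 / 2 : ℝ) • lerayBackward a 0 U ((1 / 2) ^ 2 * t) ((1 / 2 : ℝ) • x) =
      lerayBackward a 0 U t x := by
    intro t _ x
    have h := congrFun (congrFun (isSelfSimilar_lerayBackward_zero a U (1 / 2) hhalf0) t) x
    rw [nsRescale_apply] at h
    exact h
  have hp : ∀ t < 0, ∀ x, (1 / 2 : ℝ) ^ 2 * lerayBackwardPressure a 0 P ((1 / 2) ^ 2 * t)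
      ((1 / 2 : ℝ) • x) = lerayBackwardPressure a 0 P t x :=
    fun t _ x => lerayBackwardPressure_zero_dss a P hhalf0 x
  have hf0 := force_eq_zero_of_classical_dss_Iio hhalf0 hhalf1 hsol hu hp hf
  refine ⟨hf0, ?_⟩
  -- the pair solves the UNFORCED system on `(-∞, 0)`
  have hsol0 : IsClassicalNSSolutionOn (Iio 0) ν 0 (lerayBackward a 0 U)
      (lerayBackwardPressure a 0 P) :=
    { smooth_velocity := hsol.smooth_velocity
      smooth_pressure := hsol.smooth_pressure
      momentum := fun t ht x => by
        have h := hsol.momentum t ht x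
        rw [hf0 t ht x] at h
        simpa using h
      divFree := hsol.divFree }
  exact (lerayBackward_isClassical_iff_holds ha hU hP).1 hsol0

/-- **No Leray-type exactly self-similar blow-up for the FORCED Navier–Stokes system with an
integrable profile** (`E–C` endpoint audit, cell `ns-blowup`: "EXACT-ANSATZ WALL", kernel form,
unconditional). On `ℝ³`: let `ν > 0`, `a > 0`, `U, P` smooth with `U ∈ L^q(ℝ³)` for some
`3 ≤ q < ∞`. If Leray's backward ansatz built on `(U, P)` solves the Navier–Stokes system on
`(-∞, 0) × ℝ³` with ANY force `f` that is continuous at the blow-up point `(0, 0)` — in particular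
with a Clay-class force, smooth through the blow-up time — then `U = 0`: there is no singularity.
Inputs, all proved in the tree: `isLerayProfile_of_forced_lerayBackward` (this file: the force
vanishes, the profile system holds) and the exclusions of unforced exact self-similarity,
Nečas–Růžička–Šverák 1996 Thm. 1 (`necas_ruzicka_sverak_holds`, `q = 3`) and Tsai 1998 Thm. 1
(`tsai_selfsimilar_holds`, `3 < q < ∞`). -/
theorem lerayBackward_forced_profile_eq_zero {ν a : ℝ} (hν : 0 < ν) (ha : 0 < a)
    {U : EuclideanSpace ℝ (Fin 3) → EuclideanSpace ℝ (Fin 3)} {P : EuclideanSpace ℝ (Fin 3) → ℝ}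
    (hU : ContDiff ℝ ∞ U) (hP : ContDiff ℝ ∞ P)
    {f : ℝ → EuclideanSpace ℝ (Fin 3) → EuclideanSpace ℝ (Fin 3)}
    (hsol : IsClassicalNSSolutionOn (Iio 0) ν f (lerayBackward a 0 U) (lerayBackwardPressure a 0 P))
    (hf : ContinuousAt (uncurry f) ((0 : ℝ), (0 : EuclideanSpace ℝ (Fin 3))))
    {q : ℝ≥0∞} (hq : 3 ≤ q) (hq' : q < ⊤) (hUq : MemLp U q volume) : U = 0 := by
  have hprof := (isLerayProfile_of_forced_lerayBackward ha hU hP hsol hf).2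
  rcases eq_or_lt_of_le hq with h3 | h3
  · rw [← h3] at hUq
    exact necas_ruzicka_sverak_holds hν ha hprof hUq
  · exact tsai_selfsimilar_holds hν ha hprof h3 hq' hUq

end Leray

/-! ### Discretely self-similar Type-I blow-up with factor near one (Chae–Wolf) and a force -/

section ChaeWolf

/-- **No Type-I discretely self-similar blow-up with factor near `1` for the FORCED system, if the
force is continuous at the singular point** (Chae–Wolf 2017, Thm. 1.3, made force-proof; cell
`ns-blowup` KILLSHEET K11-F). For every Type-I constant `C₀ > 0` there is `c₁ > 1` such that for
`1 < c < c₁`: if `(u, p)` is a classical solution of the forced Navier–Stokes system (`ν = 1`) on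
`(-∞, 0) × ℝ³` with force `f`, the PAIR is `c`-DSS (`c u(c²t, cx) = u(t,x)`, `c² p(c²t, cx) = p(t,x)`),
`u` obeys the Type-I bound `‖u(t,x)‖ ≤ C₀/(‖x‖ + √(-t))`, and `f` is continuous at the vertex
`(0, 0)`, then `u ≡ 0` on `(-∞, 0) × ℝ³`. Proof: `force_eq_zero_of_classical_dss_Iio` with
`λ = c⁻¹ ∈ (0, 1)` kills the force, and the tree's DISCHARGED `chaeWolf2017_removing_dss_holds`
applies to the now unforced solution. Unconditional. -/
theorem dss_typeI_forced_eq_zero {C₀ : ℝ} (hC₀ : 0 < C₀) :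
    ∃ c₁ : ℝ, 1 < c₁ ∧ ∀ c : ℝ, 1 < c → c < c₁ →
      ∀ (u f : ℝ → EuclideanSpace ℝ (Fin 3) → EuclideanSpace ℝ (Fin 3))
        (p : ℝ → EuclideanSpace ℝ (Fin 3) → ℝ),
        IsClassicalNSSolutionOn (Iio 0) 1 f u p → IsDiscretelySelfSimilar c u →
        (∀ t x, c ^ 2 * p (c ^ 2 * t) (c • x) = p t x) → HasTypeIDecay C₀ u →
        ContinuousAt (uncurry f) ((0 : ℝ), (0 : EuclideanSpace ℝ (Fin 3))) →
        ∀ t < 0, ∀ x, u t x = 0 := by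
  obtain ⟨c₁, hc₁, hcw⟩ := chaeWolf2017_removing_dss_holds C₀ hC₀
  refine ⟨c₁, hc₁, fun c hc1 hcc₁ u f p hsol hdss hp hI hf => ?_⟩
  have hc0 : 0 < c := lt_trans zero_lt_one hc1
  set l : ℝ := c⁻¹ with hl
  have hl0 : 0 < l := inv_pos.2 hc0
  have hl1 : l < 1 := inv_lt_one_of_one_lt₀ hc1
  have hlc : l * c = 1 := inv_mul_cancel₀ hc0.ne'
  -- the pair is `l`-DSS with `l = c⁻¹ ∈ (0, 1)`
  have hu : ∀ t < 0, ∀ x, l • u (l ^ 2 * t) (l • x) = u t x := by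
    intro t _ x
    have h := congrFun (congrFun hdss (l ^ 2 * t)) (l • x)
    rw [nsRescale_apply, smul_smul, show c ^ 2 * (l ^ 2 * t) = t by
      rw [← mul_assoc, ← mul_pow, mul_comm c l, hlc, one_pow, one_mul],
      show c * l = 1 by rw [mul_comm, hlc], one_smul] at h
    -- `h : c • u t x = u (l²t) (l x)`
    rw [← h, smul_smul, hlc, one_smul]
  have hp' : ∀ t < 0, ∀ x, l ^ 2 * p (l ^ 2 * t) (l • x) = p t x := by
    intro t _ x
    have h := hp (l ^ 2 * t) (l • x)
    rw [smul_smul, show c ^ 2 * (l ^ 2 * t) = t by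
      rw [← mul_assoc, ← mul_pow, mul_comm c l, hlc, one_pow, one_mul],
      show c * l = 1 by rw [mul_comm, hlc], one_smul] at h
    -- `h : c² p t x = p (l²t) (l x)`
    rw [← h, ← mul_assoc, ← mul_pow, hlc, one_pow, one_mul]
  -- the force vanishes on `(-∞, 0) × ℝ³`
  have hf0 := force_eq_zero_of_classical_dss_Iio hl0 hl1 hsol hu hp' hf
  -- so `(u, p)` solves the UNFORCED system there, and Chae–Wolf applies
  have hsol0 : IsClassicalNSSolutionOn (Iio 0) 1 0 u p :=
    { smooth_velocity := hsol.smooth_velocity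
      smooth_pressure := hsol.smooth_pressure
      momentum := fun t ht x => by
        have h := hsol.momentum t ht x
        rw [hf0 t ht x] at h
        simpa using h
      divFree := hsol.divFree }
  exact hcw c hc1 hcc₁ u p hsol0 hdss hI

end ChaeWolf

end Summit.NavierStokesRegularity.FluidComputer.SelfSimilarForceVanishing
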